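import Literature.NumberTheory.Sieve.SmoothTwistedSaddleRange
import HarnessLib

/-!
# The twisted saddle point at the scales `x/e`, long frequency range: bookkeeping of the tails

Topic `Literature/NumberTheory/Sieve`; a PROVED tool file for `SmoothTwistedSaddleWindowLong`
([HildebrandTenenbaum1986, §4 (Lemmas 10–11)], [Harper2016, §5]). In the quantitative window theorem
for frequencies `|λ| ≤ Λ ≤ y⁷` the cutoff of the Perron-type integral is `T = Λ^{3/2} L`
(`L = log x`), and the two tail terms of the error bracket of
`TwistedWeight.norm_scaledSum_sub_main_le_window₂_decay` are bounded here, in the format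
`≤ (5/8)(a/L)` of `SmoothTwistedSaddleWindow`:

* `long_cutoff`, `long_cutoff_le`: `3 ≤ T`, `T² = Λ³L²`, `Λ⁴L³ ≤ T³`, `T ≤ Λ²L`, `T ≤ y¹²`;
* `long_decayConst_le`: the sharpened kernel-decay constant `2 + 6X + 6X² + X³C_λ/T³` (`X = 2π|λ|`,
  `C_λ = 2 + 6X + 6X² + X³ ≤ 750Λ³`, `TwistedWeight.decayConst_le`) is `≤ 278Λ²` once `T³ ≥ Λ⁴L³`,
  `L ≥ 64`;
* `long_decay_le`: the kernel tail `2π(…)√φ₂(1+|λ|)/T² ≤ (5/8)(11200/L)`;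
* `long_farrange_le`: the far range `2π e^{−cL/log y} T √φ₂ (1+|λ|) ≤ (5/8)(41/L)` (using
  `Λ³ ≤ y²¹ = e^{21 log y}`, `log y ≤ r = L^{1/5}`, `L³ ≤ e^{15r}`, `c r ≥ 36`).

## References

* A. Hildebrand, G. Tenenbaum, Trans. AMS 296 (1986), §4 (Lemmas 10–11) [HildebrandTenenbaum1986].
* A. J. Harper, Compositio Math. 152 (2016), §5 [Harper2016].
-/

noncomputable section

open Real Complex MeasureTheory Set Filter
open scoped FourierTransform Topology

namespace Literature.NumberTheory.Sieve

namespace TwistedWeight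

/-! ### Bookkeeping for the cutoff `T = Λ^{3/2} log x` -/

/-- **The cutoff** `T = √(Λ³)·L` (`Λ ≥ 1`, `L ≥ 16`): `3 ≤ T`, `T² = Λ³L²`, `Λ⁴L³ ≤ T³`, `T ≤ Λ²L`.
[folklore] -/
theorem long_cutoff {Λ L T : ℝ} (hΛ1 : 1 ≤ Λ) (hL : 16 ≤ L) (hT : T = Real.sqrt (Λ ^ 3) * L) :
    3 ≤ T ∧ T ^ 2 = Λ ^ 3 * L ^ 2 ∧ Λ ^ 4 * L ^ 3 ≤ T ^ 3 ∧ T ≤ Λ ^ 2 * L := by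
  have hΛ0 : 0 < Λ := by linarith
  have hL0 : 0 < L := by linarith
  set S := Real.sqrt (Λ ^ 3) with hS
  have hS2 : S ^ 2 = Λ ^ 3 := Real.sq_sqrt (by positivity)
  have hSge : Λ ≤ S := by
    rw [hS, Real.le_sqrt hΛ0.le (by positivity)]; nlinarith
  have hSle : S ≤ Λ ^ 2 := by
    rw [hS, Real.sqrt_le_left (by positivity)]; nlinarith
  refine ⟨?_, ?_, ?_, ?_⟩
  · rw [hT]; nlinarith
  · rw [hT, mul_pow, hS2]
  · rw [hT, mul_pow]
    have h1 : Λ ^ 4 ≤ S ^ 3 := by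
      calc Λ ^ 4 = Λ ^ 3 * Λ := by ring
        _ ≤ S ^ 2 * S := by rw [hS2]; exact mul_le_mul_of_nonneg_left hSge (by positivity)
        _ = S ^ 3 := by ring
    exact mul_le_mul_of_nonneg_right h1 (by positivity)
  · rw [hT]; exact mul_le_mul_of_nonneg_right hSle hL0.le

/-- `T ≤ Y¹²` when `T² = Λ³L²`, `Λ ≤ Y⁷`, `L⁴ ≤ Y`, `L ≥ 1`, `Y ≥ 1`. [folklore] -/
theorem long_cutoff_le {Λ L T Y : ℝ} (hΛ0 : 0 ≤ Λ) (hΛY : Λ ≤ Y ^ 7) (hL1 : 1 ≤ L) (hLY : L ^ 4 ≤ Y)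
    (hY1 : 1 ≤ Y) (hT2 : T ^ 2 = Λ ^ 3 * L ^ 2) : T ≤ Y ^ 12 := by
  refine le_of_pow_le_pow_left₀ two_ne_zero (by positivity) ?_
  rw [hT2]
  have h1 : Λ ^ 3 ≤ Y ^ 21 := by
    calc Λ ^ 3 ≤ (Y ^ 7) ^ 3 := pow_le_pow_left₀ hΛ0 hΛY 3
      _ = Y ^ 21 := by ring
  have h2 : L ^ 2 ≤ Y := le_trans (pow_le_pow_right₀ hL1 (by norm_num : 2 ≤ 4)) hLY
  calc Λ ^ 3 * L ^ 2 ≤ Y ^ 21 * Y := mul_le_mul h1 h2 (by positivity) (by positivity)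
    _ = Y ^ 22 := by ring
    _ ≤ Y ^ 24 := pow_le_pow_right₀ hY1 (by norm_num)
    _ = (Y ^ 12) ^ 2 := by ring

/-- **The sharpened kernel-decay constant**: for `|λ| ≤ Λ`, `Λ ≥ 1`, `T³ ≥ Λ⁴L³`, `L ≥ 64`, with
`X = 2π|λ|`, `C_λ = 2 + 6X + 6X² + X³ ≤ 750Λ³`: `2 + 6X + 6X² + X³C_λ/T³ ≤ 278Λ²`. [folklore] -/
theorem long_decayConst_le {lam Λ T L : ℝ} (hΛ1 : 1 ≤ Λ) (hlam : |lam| ≤ Λ) (hL : 64 ≤ L) (hT0 : 0 < T)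
    (hT3 : Λ ^ 4 * L ^ 3 ≤ T ^ 3) :
    2 + 6 * (2 * π * |lam|) + 6 * (2 * π * |lam|) ^ 2 + (2 * π * |lam|) ^ 3 *
        ((2 + 6 * (2 * π * |lam|) + 6 * (2 * π * |lam|) ^ 2 + (2 * π * |lam|) ^ 3) / T ^ 3) ≤
      278 * Λ ^ 2 := by
  have hπ4 := Real.pi_lt_d4
  have hπ0 := Real.pi_pos
  have hΛ0 : 0 < Λ := by linarith
  have hL0 : 0 < L := by linarith
  have h0 : 0 ≤ |lam| := abs_nonneg lam
  have hC : 2 + 6 * (2 * π * |lam|) + 6 * (2 * π * |lam|) ^ 2 + (2 * π * |lam|) ^ 3 ≤ 750 * Λ ^ 3 :=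
    decayConst_le hΛ1 hlam
  have hX0 : 0 ≤ 2 * π * |lam| := by positivity
  set X : ℝ := 2 * π * |lam| with hX
  have hX1 : X ≤ 6.2832 * Λ := by rw [hX]; nlinarith
  have hX3 : X ^ 3 ≤ (6.2832 * Λ) ^ 3 := pow_le_pow_left₀ hX0 hX1 3
  -- the damped top-order term is `≤ Λ²`
  have hlast : X ^ 3 * ((2 + 6 * X + 6 * X ^ 2 + X ^ 3) / T ^ 3) ≤ Λ ^ 2 := by
    rw [mul_div_assoc', div_le_iff₀ (by positivity)]
    calc X ^ 3 * (2 + 6 * X + 6 * X ^ 2 + X ^ 3) ≤ (6.2832 * Λ) ^ 3 * (750 * Λ ^ 3) :=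
          mul_le_mul hX3 hC (by positivity) (by positivity)
      _ = (6.2832 ^ 3 * 750) * (Λ ^ 2 * Λ ^ 4) := by ring
      _ ≤ Λ ^ 2 * (Λ ^ 4 * L ^ 3) := by
          have hL3 : (64 : ℝ) ^ 3 ≤ L ^ 3 := pow_le_pow_left₀ (by norm_num) hL 3
          have hΛ6 : 0 ≤ Λ ^ 2 * Λ ^ 4 := by positivity
          have h1 := mul_le_mul_of_nonneg_left hL3 hΛ6
          nlinarith [h1, hΛ6]
      _ ≤ Λ ^ 2 * T ^ 3 := mul_le_mul_of_nonneg_left hT3 (by positivity)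
  have hX2 : X ^ 2 ≤ 39.47860224 * Λ ^ 2 := by nlinarith [hX1, hX0]
  have hΛsq : Λ ≤ Λ ^ 2 := by nlinarith
  have h1Λ : 1 ≤ Λ ^ 2 := by nlinarith
  linarith [hlast, hX1, hX2, hΛsq, h1Λ]

/-- **The kernel-decay term, long range**: with the constant of `long_decayConst_le`, `T² = Λ³L²`,
`√φ ≤ 2L`, `1 + |λ| ≤ 2Λ`: `2π(2 + 6X + 6X² + X³C_λ/T³)√φ(1+|λ|)/T² ≤ 2224π/L ≤ (5/8)(11200/L)`.
[folklore] -/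
theorem long_decay_le {lam Λ T L Φ : ℝ} (hΛ1 : 1 ≤ Λ) (hlam : |lam| ≤ Λ) (hL : 64 ≤ L) (hT0 : 0 < T)
    (hT2 : T ^ 2 = Λ ^ 3 * L ^ 2) (hT3 : Λ ^ 4 * L ^ 3 ≤ T ^ 3) (hΦ0 : 0 ≤ Φ) (hΦle : Φ ≤ 2 * L) :
    2 * Real.pi * (2 + 6 * (2 * π * |lam|) + 6 * (2 * π * |lam|) ^ 2 + (2 * π * |lam|) ^ 3 *
        ((2 + 6 * (2 * π * |lam|) + 6 * (2 * π * |lam|) ^ 2 + (2 * π * |lam|) ^ 3) / T ^ 3)) / T ^ 2 * Φ *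
      (1 + |lam|) ≤ 5 / 8 * (11200 / L) := by
  have hNle : 2 + 6 * (2 * π * |lam|) + 6 * (2 * π * |lam|) ^ 2 + (2 * π * |lam|) ^ 3 *
      ((2 + 6 * (2 * π * |lam|) + 6 * (2 * π * |lam|) ^ 2 + (2 * π * |lam|) ^ 3) / T ^ 3) ≤ 278 * Λ ^ 2 :=
    long_decayConst_le hΛ1 hlam hL hT0 hT3
  set N : ℝ := 2 + 6 * (2 * π * |lam|) + 6 * (2 * π * |lam|) ^ 2 + (2 * π * |lam|) ^ 3 *
      ((2 + 6 * (2 * π * |lam|) + 6 * (2 * π * |lam|) ^ 2 + (2 * π * |lam|) ^ 3) / T ^ 3) with hN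
  have hπ4 := Real.pi_lt_d4
  have hL0 : 0 < L := by linarith
  have hΛ0 : 0 < Λ := by linarith
  have hlam1 : 1 + |lam| ≤ 2 * Λ := by linarith only [hlam, hΛ1]
  have hlam0 : 0 < 1 + |lam| := by positivity
  have key : N * Φ * (1 + |lam|) ≤ 278 * Λ ^ 2 * (2 * L) * (2 * Λ) :=
    mul_le_mul (mul_le_mul hNle hΦle hΦ0 (by positivity)) hlam1 hlam0.le (by positivity)
  rw [hT2]
  calc 2 * Real.pi * N / (Λ ^ 3 * L ^ 2) * Φ * (1 + |lam|)
      = 2 * Real.pi * (N * Φ * (1 + |lam|)) / (Λ ^ 3 * L ^ 2) := by ring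
    _ ≤ 2 * Real.pi * (278 * Λ ^ 2 * (2 * L) * (2 * Λ)) / (Λ ^ 3 * L ^ 2) :=
        div_le_div_of_nonneg_right (mul_le_mul_of_nonneg_left key (by positivity)) (by positivity)
    _ = 2224 * Real.pi / L := by field_simp; ring
    _ ≤ 5 / 8 * (11200 / L) := by
        rw [show 5 / 8 * (11200 / L) = 7000 / L by ring]
        exact div_le_div_of_nonneg_right (by nlinarith only [hπ4]) hL0.le

/-- **The far-range decay term, long range**: with `ε₂ = exp(−cL/ℓ)`, `T ≤ Λ²L`, `√φ ≤ 2L`,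
`1+|λ| ≤ 2Λ`, `Λ ≤ Y⁷`, `Y = e^ℓ`, `0 < ℓ ≤ r`, `r⁵ = L`, `cr ≥ 36`:
`2π ε₂ T √φ (1+|λ|) ≤ 8π L² Λ³ ε₂ ≤ 8π e^{15r} e^{21r} e^{−36r}/L ≤ (5/8)(41/L)`. [folklore] -/
theorem long_farrange_le {c r L ℓ Φ Λ lam T Y : ℝ} (hc : 0 < c) (hr1 : 1 ≤ r) (hr5 : r ^ 5 = L)
    (hcr : 36 ≤ c * r) (hℓ0 : 0 < ℓ) (hℓr : ℓ ≤ r) (hΦ0 : 0 ≤ Φ) (hΦle : Φ ≤ 2 * L) (hΛ1 : 1 ≤ Λ)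
    (hlam : |lam| ≤ Λ) (hY : Y = Real.exp ℓ) (hΛY : Λ ≤ Y ^ 7) (hT0 : 0 ≤ T) (hTle : T ≤ Λ ^ 2 * L) :
    2 * Real.pi * Real.exp (-(c * (L / ℓ))) * T * Φ * (1 + |lam|) ≤ 5 / 8 * (41 / L) := by
  have hπ4 := Real.pi_lt_d4
  have hr0 : 0 < r := by linarith
  have hL0 : 0 < L := by rw [← hr5]; positivity
  have hΛ0 : 0 < Λ := by linarith
  have hlam1 : 1 + |lam| ≤ 2 * Λ := by linarith only [hlam, hΛ1]
  have hlam0 : 0 < 1 + |lam| := by positivity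
  -- `T √φ (1+|λ|) ≤ 4 Λ³ L²`
  have h1 : T * Φ * (1 + |lam|) ≤ Λ ^ 2 * L * (2 * L) * (2 * Λ) :=
    mul_le_mul (mul_le_mul hTle hΦle hΦ0 (by positivity)) hlam1 hlam0.le (by positivity)
  -- `Λ³ ≤ Y²¹ = e^{21ℓ} ≤ e^{21r}`
  have h2 : Λ ^ 3 ≤ Real.exp (21 * r) := by
    calc Λ ^ 3 ≤ (Y ^ 7) ^ 3 := pow_le_pow_left₀ hΛ0.le hΛY 3
      _ = Real.exp (21 * ℓ) := by
          rw [hY, ← Real.exp_nat_mul, ← Real.exp_nat_mul]; congr 1; push_cast; ring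
      _ ≤ Real.exp (21 * r) := Real.exp_le_exp.2 (by linarith only [hℓr])
  -- `L³ = r¹⁵ ≤ e^{15r}`
  have h3 : L ^ 3 ≤ Real.exp (15 * r) := by
    have hre : r ≤ Real.exp r := by linarith only [Real.add_one_le_exp r]
    calc L ^ 3 = r ^ 15 := by rw [← hr5]; ring
      _ ≤ Real.exp r ^ 15 := pow_le_pow_left₀ hr0.le hre 15
      _ = Real.exp (15 * r) := by rw [← Real.exp_nat_mul]; norm_num
  -- `e^{−cL/ℓ} ≤ e^{−36r}`: `cL/ℓ ≥ c r⁴ = (cr) r³ ≥ 36 r`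
  have h4 : Real.exp (-(c * (L / ℓ))) ≤ Real.exp (-(36 * r)) := by
    rw [Real.exp_le_exp, neg_le_neg_iff]
    have hr4 : r ^ 4 ≤ L / ℓ := by
      rw [le_div_iff₀ hℓ0]
      calc r ^ 4 * ℓ ≤ r ^ 4 * r := mul_le_mul_of_nonneg_left hℓr (by positivity)
        _ = L := by rw [← hr5]; ring
    have hr3 : r ≤ r ^ 3 := by
      have := pow_le_pow_right₀ hr1 (by norm_num : 1 ≤ 3); rwa [pow_one] at this
    have h5 : 36 * r ^ 3 ≤ c * r * r ^ 3 := mul_le_mul_of_nonneg_right hcr (by positivity)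
    calc 36 * r ≤ 36 * r ^ 3 := by linarith only [hr3]
      _ ≤ c * r * r ^ 3 := h5
      _ = c * r ^ 4 := by ring
      _ ≤ c * (L / ℓ) := mul_le_mul_of_nonneg_left hr4 hc.le
  have hexp : Real.exp (-(36 * r)) * (Real.exp (21 * r) * Real.exp (15 * r)) = 1 := by
    rw [← Real.exp_add, ← Real.exp_add, show -(36 * r) + (21 * r + 15 * r) = 0 by ring, Real.exp_zero]
  rw [show 5 / 8 * (41 / L) = (5 / 8 * 41) / L by ring, le_div_iff₀ hL0]
  calc 2 * Real.pi * Real.exp (-(c * (L / ℓ))) * T * Φ * (1 + |lam|) * L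
      = 2 * Real.pi * Real.exp (-(c * (L / ℓ))) * (T * Φ * (1 + |lam|)) * L := by ring
    _ ≤ 2 * Real.pi * Real.exp (-(36 * r)) * (Λ ^ 2 * L * (2 * L) * (2 * Λ)) * L := by
        apply mul_le_mul_of_nonneg_right _ hL0.le
        exact mul_le_mul (mul_le_mul_of_nonneg_left h4 (by positivity)) h1 (by positivity) (by positivity)
    _ = 8 * Real.pi * (Real.exp (-(36 * r)) * (Λ ^ 3 * L ^ 3)) := by ring
    _ ≤ 8 * Real.pi * (Real.exp (-(36 * r)) * (Real.exp (21 * r) * Real.exp (15 * r))) :=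
        mul_le_mul_of_nonneg_left (mul_le_mul_of_nonneg_left
          (mul_le_mul h2 h3 (by positivity) (by positivity)) (Real.exp_pos _).le) (by positivity)
    _ = 8 * Real.pi := by rw [hexp, mul_one]
    _ ≤ 5 / 8 * 41 := by nlinarith only [hπ4]

end TwistedWeight

end Literature.NumberTheory.Sieve

end
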